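import Summits.BirchSwinnertonDyer.Rank1Residual.X1.RankZeroDoubleTwistClass
import HarnessLib

/-!
# Residual class X1 ∩ {r = 0}: the DOUBLE-TWIST road read at the leaf pair ITSELF — the certificate
# datum is an isogeny invariant, so the good lattice disappears from the per-pair currency

HONEST FRAMING (cell `bsd-eis`, home `run/shared/lean/pub/bsd-eis/`, seat `bsd-eis-k5-c5` (g2);
FULL-BSD rank-≤1 programme, ladder row A3 = class X1 ∩ {r_an = 0}; crux 5 `MazurMCOnX1RankZero` of
route `EisensteinPrimes`, item stmt-BirchSwinnertonDyer-19035). Nothing here closes the item and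
nothing is booked; no label moves. Third file of the road after `X1/RankZeroDoubleTwist.lean`
(`BSD(E',p)` at a GOOD-LATTICE leaf pair from `h308` twice + `BSD` in the isogeny class of an
admissible double twist; the datum `DoubleTwistPartnerAt`) and `X1/RankZeroDoubleTwistClass.lean`
(any leaf pair by Cassels; the rider `DoubleTwistShaAnUnitSupply`). There the datum was asked AT THE
GOOD LATTICE `E'` (Keller–Yin's normalisation: no rational `p`-line unramified at `p`), which a
booking seat would have to identify inside the class. Here we observe that the datum is an ISOGENY
INVARIANT and read it at the leaf curve `E` itself:
* the Heegner hypothesis for `N_E` depends only on the SET of bad primes (`p ∣ N_E` iff bad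
  reduction at `p`, tree theorem `dvd_conductorNorm_iff_not_hasGoodReductionAtPrime`, Diamond–Shurman
  §8.3), an isogeny invariant (`IsIsogenous.hasGoodReductionAtPrime_iff`, Silverman VII.7.2) —
  `satisfiesHeegnerHypothesis_conductorNorm_iff_of_isIsogenous` (§1; no Ogg–Saito needed);
* twisting commutes with isogenies (`IsIsogenous.quadraticTwist`, Cremona §3.9), globally minimal
  models of the twists exist (`exists_isGloballyMinimal_smul_eq_quadraticTwist`), the analytic rank
  and `L(·,1)` are isogeny invariants (`analyticRank_eq_of_isIsogenous'`,
  `entireLFunction_eq_of_isIsogenous'`, Faltings / Knapp 11.67), and "isogenous to the double twist"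
  is transitive — so `DoubleTwistPartnerAt E p → DoubleTwistPartnerAt E' p` for `E ∼ E'`
  (`doubleTwistPartnerAt_of_isIsogenous`, §2).
Consequently (§3) `BSD(E,p)` and Mazur's main conjecture at a leaf pair follow from `h308` (KY Thm.
3.0.8 (IMC2) at `𝟙`, PRE = crux 2's body), the PUBLISHED facts, and `DoubleTwistPartnerAt E p` read
at `E` — the good lattice is supplied INTERNALLY by Ribet's lemma
(`GoodLatticeExists.ribet_exists_isIsogenous_noUnramifiedLine_holds`, tree theorem) and never named by
the booking seat; and (§4) the class-wide rider takes the simpler form `DoubleTwistCertificateSupply`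
("every rank-`0` leaf pair carries the double-twist certificate"), which implies
`DoubleTwistShaAnUnitSupply`. PER-PAIR CURRENCY of road (B-ii) after this file: (⋆) = `h308` [PRE] ·
the finite datum at `E` — `d_K`, `d_{K'}`, `ord L(E^{d_K}) = 1`, `L(E^{d_K d_{K'}},1) ≠ 0`, one curve
`E_c ∼ E^{(d_K d_{K'})}` with `ord_p #Ш(E_c)_an = 0` [CERT] · [PUB]. The rider is NOT in print (see the
Class file); the road is ky MEMO-1 §5.2 (B-ii) at the h308 level.
* §1 `satisfiesHeegnerHypothesis_conductorNorm_iff_of_isIsogenous`.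
* §2 `doubleTwistPartnerAt_of_isIsogenous`.
* §3 `Leaf.bsdp_of_h308_of_doubleTwistPartnerAt`, `Leaf.mazurMainConjecture_of_h308_of_doubleTwistPartnerAt`.
* §4 `DoubleTwistCertificateSupply` (TYPED rider, `@[conjecture]`),
  `doubleTwistShaAnUnitSupply_of_certificateSupply`, `statement_of_h308_of_certificateSupply`,
  `Leaf.mazurMainConjecture_of_h308_of_certificateSupply`.
References: [KellerYin2024] Thm. 3.0.8 (IMC2), Prop. 1.3.1, proof of Thm. 4.2.1; [Ribet1976] Prop. 2.1;
[CremonaAlgorithms1997] §3.9; [DiamondShurman2005] §8.3; [SilvermanAEC2009] VII.7.2; [Wuthrich2014]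
Thm. 16, Prop. 21; [GreenbergLNM1716] Thm. 4.1; [MilneADT2006] I.7.3; HOME/bsd-eis-ky-MEMO-1.md §5.2.
-/

set_option autoImplicit false

noncomputable section

open scoped Classical

open WeierstrassCurve NumberField IsDedekindDomain Field Literature.NumberTheory.EllipticCurves
  Literature.NumberTheory.EllipticCurves.ModularForms Literature.NumberTheory.QuadraticFields
  Literature.NumberTheory.EllipticCurves.Rank1Residual
  Literature.NumberTheory.GaloisRepresentations
  Literature.NumberTheory.EllipticCurves.CastellaGrossiLeeSkinner2022
  Literature.NumberTheory.EllipticCurves.KellerYin2024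
  Summit.BirchSwinnertonDyer.Rank1Residual.X1.KellerYinGoodLattice
  Summit.BirchSwinnertonDyer.Rank1Residual.X1.KellerYinTheoremA
  Summit.BirchSwinnertonDyer.Rank1Residual.X1.RankZeroDoubleTwist
  Summit.BirchSwinnertonDyer.Rank1Residual.X1.RankZeroDoubleTwistClass
  Summit.BirchSwinnertonDyer.BirchSwinnertonDyer.Theorems
  Summit.BirchSwinnertonDyer.BirchSwinnertonDyer.Theorems.Rank1ResidualX1Defs
  Summit.BirchSwinnertonDyer.BirchSwinnertonDyer.Theorems.Rank1ResidualX1RankZeroTwist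

namespace Summit.BirchSwinnertonDyer.Rank1Residual.X1.RankZeroDoubleTwistTransport

variable {p : ℕ} [Fact p.Prime]

/-! ## §1 The Heegner hypothesis for the conductor is an isogeny invariant (prime support only) -/

/-- **`Heeg(N_E, K) ↔ Heeg(N_{E'}, K)` for `ℚ`-isogenous elliptic `E ∼ E'`.** The Heegner hypothesis
"every prime dividing `N` splits in `K`" sees only the set of primes dividing `N`; `ℓ ∣ N_E` iff
`E` has bad reduction at `ℓ` (`dvd_conductorNorm_iff_not_hasGoodReductionAtPrime`, Diamond–Shurman
§8.3 / Silverman *ATAEC* IV.10.2(a), tree theorem), and good reduction at `ℓ` is an isogeny invariant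
(`IsIsogenous.hasGoodReductionAtPrime_iff`, Silverman *AEC* VII.7.2). No conductor EQUALITY (Ogg–Saito)
is used. [cite: DiamondShurman2005, §8.3 (PDF p. 353)] [cite: SilvermanAEC2009, Cor. VII.7.2] -/
theorem satisfiesHeegnerHypothesis_conductorNorm_iff_of_isIsogenous
    {V W : WeierstrassCurve ℚ} [V.IsElliptic] [W.IsElliptic] (hiso : IsIsogenous V W)
    (K : Type) [Field K] :
    SatisfiesHeegnerHypothesis (V.conductorNorm ℤ) K ↔ SatisfiesHeegnerHypothesis (W.conductorNorm ℤ) K := by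
  have key : ∀ ℓ : ℕ, ℓ.Prime → (ℓ ∣ V.conductorNorm ℤ ↔ ℓ ∣ W.conductorNorm ℤ) := by
    intro ℓ hℓ
    haveI : Fact ℓ.Prime := ⟨hℓ⟩
    rw [V.dvd_conductorNorm_iff_not_hasGoodReductionAtPrime ℓ,
      W.dvd_conductorNorm_iff_not_hasGoodReductionAtPrime ℓ, hiso.hasGoodReductionAtPrime_iff ℓ]
  constructor
  · intro h ℓ hℓ hdvd
    exact h ℓ hℓ ((key ℓ hℓ).mpr hdvd)
  · intro h ℓ hℓ hdvd
    exact h ℓ hℓ ((key ℓ hℓ).mp hdvd)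

/-! ## §2 The double-twist certificate datum is an isogeny invariant -/

/-- **`DoubleTwistPartnerAt E p → DoubleTwistPartnerAt E' p` for `ℚ`-isogenous elliptic `E ∼ E'`.**
Given the datum at `E` — `K` admissible for `E` with a globally minimal model `Vd` of `E^{(d_K)}` of
analytic rank one, `K'` admissible for `Vd` with `L(E^{(d_K d_{K'})},1) ≠ 0`, a globally minimal model
`Vdd` of the double twist and `E_c ∼ Vdd` with `ord_p #Ш(E_c)_an = 0` — the SAME fields and the SAME
certified curve `E_c` serve `E'`: a globally minimal model `Wd` of `E'^{(d_K)}` exists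
(`exists_isGloballyMinimal_smul_eq_quadraticTwist`) and is isogenous to `Vd` (twisting commutes with
isogenies, `IsIsogenous.quadraticTwist`, Cremona §3.9; changes of model are isogenies), so it has
analytic rank one (`analyticRank_eq_of_isIsogenous'`) and the same bad primes (§1); likewise a model
`Wdd` of `Wd^{(d_{K'})}` is isogenous to `Vdd`, hence to `E_c`, and
`L(Wd^{(d_{K'})},1) = L(Vd^{(d_{K'})},1) ≠ 0` (`entireLFunction_eq_of_isIsogenous'`, Faltings).
[cite: CremonaAlgorithms1997, §3.9 (p. 87)] [cite: Knapp1993, Thm. 11.67] -/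
theorem doubleTwistPartnerAt_of_isIsogenous
    {V W : WeierstrassCurve ℚ} [V.IsElliptic] [W.IsElliptic] (hiso : IsIsogenous V W)
    (hDT : DoubleTwistPartnerAt V p) : DoubleTwistPartnerAt W p := by
  obtain ⟨K, _, _, hK, hodd, hlt, hHN, hHp, Vd, _, _, ⟨C, hC⟩, hrd, K', _, _, hK', hodd', hlt', hHN',
    hHp', hLt', Vdd, _, _, ⟨C', hC'⟩, Wc, _, _, hisoc, hunit⟩ := hDT
  have hd0 : (NumberField.discr K : ℚ) ≠ 0 := by
    exact_mod_cast (IsImaginaryQuadratic.discr_neg hK).ne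
  have hd0' : (NumberField.discr K' : ℚ) ≠ 0 := by
    exact_mod_cast (IsImaginaryQuadratic.discr_neg hK').ne
  -- a globally minimal model `Wd` of `W^{(d_K)}`, isogenous to `Vd`
  obtain ⟨Wd, _, _, D, hD⟩ := exists_isGloballyMinimal_smul_eq_quadraticTwist W hd0
  have hisod : IsIsogenous Vd Wd :=
    IsIsogenous.trans' (IsIsogenous.trans' (isIsogenous_of_smul_eq hC) (hiso.quadraticTwist hd0))
      (isIsogenous_of_smul_eq' hD)
  -- a globally minimal model `Wdd` of `Wd^{(d_{K'})}`, isogenous to `Vdd`, hence to `Wc`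
  obtain ⟨Wdd, _, _, D', hD'⟩ := exists_isGloballyMinimal_smul_eq_quadraticTwist Wd hd0'
  have hisodd : IsIsogenous Vdd Wdd :=
    IsIsogenous.trans' (IsIsogenous.trans' (isIsogenous_of_smul_eq hC') (hisod.quadraticTwist hd0'))
      (isIsogenous_of_smul_eq' hD')
  have hisoc' : IsIsogenous Wdd Wc := IsIsogenous.trans' hisodd.symm_of_charZero hisoc
  -- transport of the analytic data
  have hrd' : Wd.analyticRank = 1 := (analyticRank_eq_of_isIsogenous' hisod).symm.trans hrd
  have hHN'' : SatisfiesHeegnerHypothesis (Wd.conductorNorm ℤ) K' :=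
    (satisfiesHeegnerHypothesis_conductorNorm_iff_of_isIsogenous hisod K').mp hHN'
  haveI := Vd.isElliptic_quadraticTwist hd0'
  haveI := Wd.isElliptic_quadraticTwist hd0'
  have hLt'' : (Wd.quadraticTwist (NumberField.discr K' : ℚ)).entireLFunction 1 ≠ 0 := by
    rw [← entireLFunction_eq_of_isIsogenous' (hisod.quadraticTwist hd0')]
    exact hLt'
  exact ⟨K, inferInstance, inferInstance, hK, hodd, hlt,
    (satisfiesHeegnerHypothesis_conductorNorm_iff_of_isIsogenous hiso K).mp hHN, hHp, Wd,
    inferInstance, inferInstance, ⟨D, hD⟩, hrd', K', inferInstance, inferInstance, hK', hodd', hlt',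
    hHN'', hHp', hLt'', Wdd, inferInstance, inferInstance, ⟨D', hD'⟩, Wc, inferInstance, inferInstance,
    hisoc', hunit⟩

/-! ## §3 `BSD(E,p)` and Mazur's main conjecture at a leaf pair from `h308` + the datum AT THE LEAF
CURVE (the good lattice supplied by Ribet's lemma, never named) -/

/-- **`BSD(E,p)` at a rank-`0` leaf pair from `h308`, the PUBLISHED facts and the double-twist
certificate datum read at `E` itself.** For a leaf pair `(E,p)` (`RankZero.Leaf V p`) carrying
`DoubleTwistPartnerAt V p`: Ribet's lemma (tree theorem
`GoodLatticeExists.ribet_exists_isIsogenous_noUnramifiedLine_holds`) supplies a KY-normalised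
`W ∼ V`; the datum transports to `W` (§2); `X1.RankZeroDoubleTwistClass.Leaf.bsdp_of_isIsogenous_goodLattice_of_h308_of_doubleTwistPartnerAt`
concludes. Inputs: `h308` (KY Thm. 3.0.8 (IMC2) at `𝟙`, PRE), CGLS 5.1.1 (`h511`), Wuthrich Prop. 21
(`hW`), Cassels (`hCassels`), modularity (`hmodP`, `hmod`), Gross–Zagier (`hGZQ`, `hGZ`), Kolyvagin
(`hKo`), GZK (`hGZK`). [claim: KellerYin2024, status: under-review]
[cite: KellerYin2024, Thm. 3.0.8 (IMC2), Prop. 1.3.1] [cite: Ribet1976, Prop. 2.1]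
[cite: Wuthrich2014, Prop. 21 (p. 400)] [cite: MilneADT2006, Thm. I.7.3] -/
theorem Leaf.bsdp_of_h308_of_doubleTwistPartnerAt
    (h308 : thm308_imc2_bdpValue_goodLattice_OPEN) (h511 : thm511_anticyclotomicControl_of_torsionFree)
    (hW : Wuthrich2014.sha_dvd_analyticSha) (hCassels : bsdRHS_eq_of_isIsogenous)
    (hmodP : nonempty_modularParametrizationData) (hmod : exists_isNewformOf)
    (hGZQ : GrossZagier1986_thm_I_7_3)
    (hGZ : ∀ (N : ℕ) [NeZero N] (W : WeierstrassCurve ℚ) (K : Type) [Field K] [NumberField K],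
      gross_zagier N W K)
    (hKo : ∀ (N : ℕ) [NeZero N] (W : WeierstrassCurve ℚ) (K : Type) [Field K] [NumberField K],
      kolyvagin N W K)
    (hGZK : rank_eq_analyticRank_of_analyticRank_le_one)
    (V : WeierstrassCurve ℚ) [V.IsElliptic] [V.IsGloballyMinimal] (hL : RankZero.Leaf V p)
    (hDT : DoubleTwistPartnerAt V p) : BSDp V p := by
  obtain ⟨hp, hred, hgood, -, -⟩ := hL.classX1
  obtain ⟨W, _, _, hiso, hGL⟩ :=
    GoodLatticeExists.ribet_exists_isIsogenous_noUnramifiedLine_holds V p hp hgood hred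
  exact RankZeroDoubleTwistClass.Leaf.bsdp_of_isIsogenous_goodLattice_of_h308_of_doubleTwistPartnerAt
    h308 h511 hW hCassels hmodP hmod hGZQ hGZ hKo hGZK V hL W hiso hGL
    (doubleTwistPartnerAt_of_isIsogenous hiso hDT)

/-- **Mazur's main conjecture at a rank-`0` leaf pair from `h308`, the PUBLISHED facts (+ Wuthrich
Thm. 16 `hW16`, Greenberg Thm. 4.1 `hGr` for the converse chain) and the datum read at `E`.**
[cite: Wuthrich2014, Thm. 16 (p. 397), Prop. 21 (p. 400)] [cite: GreenbergLNM1716, Thm. 4.1]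
[cite: KellerYin2024, Thm. 3.0.8 (IMC2)] -/
theorem Leaf.mazurMainConjecture_of_h308_of_doubleTwistPartnerAt
    (h308 : thm308_imc2_bdpValue_goodLattice_OPEN) (h511 : thm511_anticyclotomicControl_of_torsionFree)
    (hW : Wuthrich2014.sha_dvd_analyticSha) (hCassels : bsdRHS_eq_of_isIsogenous)
    (hmodP : nonempty_modularParametrizationData) (hmod : exists_isNewformOf)
    (hGZQ : GrossZagier1986_thm_I_7_3)
    (hGZ : ∀ (N : ℕ) [NeZero N] (W : WeierstrassCurve ℚ) (K : Type) [Field K] [NumberField K],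
      gross_zagier N W K)
    (hKo : ∀ (N : ℕ) [NeZero N] (W : WeierstrassCurve ℚ) (K : Type) [Field K] [NumberField K],
      kolyvagin N W K)
    (hGZK : rank_eq_analyticRank_of_analyticRank_le_one)
    (hW16 : Wuthrich2014.charIdeal_dvd_padicLFunction) (hGr : greenberg_charValue_rankZero)
    (V : WeierstrassCurve ℚ) [V.IsElliptic] [V.IsGloballyMinimal] (hL : RankZero.Leaf V p)
    (hDT : DoubleTwistPartnerAt V p) : MazurMainConjecture V p :=
  (RankZero.Leaf.mazurMainConjecture_iff_bsdp hW16 hGr hmodP hGZK hL).mpr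
    (Leaf.bsdp_of_h308_of_doubleTwistPartnerAt h308 h511 hW hCassels hmodP hmod hGZQ hGZ hKo hGZK V hL
      hDT)

/-! ## §4 The rider, read at the leaf curve -/

/-- **RIDER, leaf form (TYPED; nothing asserted): every rank-`0` leaf pair `(E,p)` carries the
double-twist certificate `DoubleTwistPartnerAt E p`** — two admissible fields `K`, `K'` with
`ord_{s=1} L(E^{(d_K)},s) = 1`, `L(E^{(d_K d_{K'})},1) ≠ 0`, and a curve isogenous to the double twist
with `p ∤ #Ш_an`. It implies the Class file's `DoubleTwistShaAnUnitSupply`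
(`doubleTwistShaAnUnitSupply_of_certificateSupply`). CLASS-WIDE NOT IN PRINT (an indivisibility
statement for the algebraic central values of real quadratic twists by products of two admissible
discriminants; nearest print Vatsal 1999, Ono–Skinner 1998, Beckwith–Raum–Richter 2024); per pair a
finite computation, which the seat ran on five leaf classes (`11a@5`, `14a@3`, `26b@7`, `19a@3`,
`35a@3`: certificate found at the first admissible pairs, e.g. `11a@5` with `(d_K, d_{K'}) = (-19,-51)`,
`#Ш_an = 1` on two members of the double twist's class; kit job j253352, PARI via cypari2).
[cite: Wuthrich2014, Prop. 21 (p. 400)] [cite: KellerYin2024, proof of Thm. 4.2.1 (the display; nothing asserted)] -/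
@[conjecture] def DoubleTwistCertificateSupply : Prop :=
  ∀ (V : WeierstrassCurve ℚ) [V.IsElliptic] [V.IsGloballyMinimal] (p : ℕ) [Fact p.Prime],
    RankZero.Leaf V p → DoubleTwistPartnerAt V p

/-- The leaf form of the rider implies the good-lattice form (Ribet's lemma supplies the lattice,
§2 transports the datum). [cite: Ribet1976, Prop. 2.1] [cite: KellerYin2024, Prop. 1.3.1] -/
theorem doubleTwistShaAnUnitSupply_of_certificateSupply (hC : DoubleTwistCertificateSupply) :
    DoubleTwistShaAnUnitSupply := by
  intro V _ _ p _ hL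
  obtain ⟨hp, hred, hgood, -, -⟩ := hL.classX1
  obtain ⟨W, _, _, hiso, hGL⟩ :=
    GoodLatticeExists.ribet_exists_isIsogenous_noUnramifiedLine_holds V p hp hgood hred
  exact ⟨W, inferInstance, inferInstance, hiso, hGL, doubleTwistPartnerAt_of_isIsogenous hiso (hC V p hL)⟩

/-- **`X1.RankZero.Statement` (`BSD(E,p)` at every rank-`0` leaf pair) from `h308` + the leaf rider
+ PUB.** [claim: KellerYin2024, status: under-review] [cite: KellerYin2024, Thm. 3.0.8 (IMC2)]
[cite: Wuthrich2014, Prop. 21 (p. 400)] -/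
theorem statement_of_h308_of_certificateSupply
    (h308 : thm308_imc2_bdpValue_goodLattice_OPEN) (hC : DoubleTwistCertificateSupply)
    (h511 : thm511_anticyclotomicControl_of_torsionFree)
    (hW : Wuthrich2014.sha_dvd_analyticSha) (hCassels : bsdRHS_eq_of_isIsogenous)
    (hmodP : nonempty_modularParametrizationData) (hmod : exists_isNewformOf)
    (hGZQ : GrossZagier1986_thm_I_7_3)
    (hGZ : ∀ (N : ℕ) [NeZero N] (W : WeierstrassCurve ℚ) (K : Type) [Field K] [NumberField K],
      gross_zagier N W K)
    (hKo : ∀ (N : ℕ) [NeZero N] (W : WeierstrassCurve ℚ) (K : Type) [Field K] [NumberField K],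
      kolyvagin N W K)
    (hGZK : rank_eq_analyticRank_of_analyticRank_le_one) : RankZero.Statement :=
  RankZeroDoubleTwistClass.statement_of_h308_of_doubleTwistSupply h308
    (doubleTwistShaAnUnitSupply_of_certificateSupply hC) h511 hW hCassels hmodP hmod hGZQ hGZ hKo hGZK

/-- **Mazur's main conjecture at EVERY rank-`0` leaf pair from `h308` + the leaf rider + PUB** — the
body of crux 5 `MazurMCOnX1RankZero`. [claim: KellerYin2024, status: under-review]
[cite: KellerYin2024, Thm. 3.0.8 (IMC2)] [cite: Wuthrich2014, Thm. 16 (p. 397), Prop. 21 (p. 400)]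
[cite: GreenbergLNM1716, Thm. 4.1] -/
theorem Leaf.mazurMainConjecture_of_h308_of_certificateSupply
    (h308 : thm308_imc2_bdpValue_goodLattice_OPEN) (hC : DoubleTwistCertificateSupply)
    (h511 : thm511_anticyclotomicControl_of_torsionFree)
    (hW : Wuthrich2014.sha_dvd_analyticSha) (hCassels : bsdRHS_eq_of_isIsogenous)
    (hmodP : nonempty_modularParametrizationData) (hmod : exists_isNewformOf)
    (hGZQ : GrossZagier1986_thm_I_7_3)
    (hGZ : ∀ (N : ℕ) [NeZero N] (W : WeierstrassCurve ℚ) (K : Type) [Field K] [NumberField K],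
      gross_zagier N W K)
    (hKo : ∀ (N : ℕ) [NeZero N] (W : WeierstrassCurve ℚ) (K : Type) [Field K] [NumberField K],
      kolyvagin N W K)
    (hGZK : rank_eq_analyticRank_of_analyticRank_le_one)
    (hW16 : Wuthrich2014.charIdeal_dvd_padicLFunction) (hGr : greenberg_charValue_rankZero)
    (V : WeierstrassCurve ℚ) [V.IsElliptic] [V.IsGloballyMinimal] (hL : RankZero.Leaf V p) :
    MazurMainConjecture V p :=
  Leaf.mazurMainConjecture_of_h308_of_doubleTwistPartnerAt h308 h511 hW hCassels hmodP hmod hGZQ hGZ hKo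
    hGZK hW16 hGr V hL (hC V p hL)

end Summit.BirchSwinnertonDyer.Rank1Residual.X1.RankZeroDoubleTwistTransport

end
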